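import Literature.Combinatorics.Enumerative.MultivariateAperyNumbers
import HarnessLib

/-!
# Straub's rational generating functions for the multivariate Apéry numbers — proofs

Topic `Literature/Combinatorics/Enumerative`.  This leaf DISCHARGES the two named facts of
`MultivariateAperyNumbers` that state A. Straub, *Multivariate Apéry numbers and supercongruences of
rational functions*, Algebra & Number Theory **8** (2014) [Straub2014], Theorem 1.1 with (7)–(8) and
Example 3.4 (24):

* `example34_genFun_holds` : `((1 − x₁ − x₂)(1 − x₃) − x₁x₂x₃) · Σ_{𝐧 ≥ 0} B(𝐧) 𝐱^𝐧 = 1` in `ℤ⟦x₁,x₂,x₃⟧`,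
  `B(n₁,n₂,n₃) = Σ_k C(n₁,k) C(n₁+n₂−k,n₁) C(n₃,k)` (`straubB`);
* `theorem11_holds` : `((1 − x₁ − x₂)(1 − x₃ − x₄) − x₁x₂x₃x₄) · Σ_{𝐧 ≥ 0} A(𝐧) 𝐱^𝐧 = 1` in `ℤ⟦x₁,…,x₄⟧`,
  `A(𝐧) = Σ_k C(n₁,k) C(n₃,k) C(n₁+n₂−k,n₁) C(n₃+n₄−k,n₃)` (`straubA`).

## Proof (coefficientwise; the printed route made finite)

Straub proves Theorem 3.1 (of which both statements are instances, `λ = (2,1)` and `λ = (2,2)`,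
`α = 1`) by expanding `(∏_j (1 − Σ_r x_{s(j)+r}) − α x₁⋯x_d)^{-1}` as the geometric series
`Σ_k α^k (x₁⋯x_d)^k ∏_j (1 − Σ_r x_{s(j)+r})^{-(k+1)}` and reading off multinomial coefficients
[Straub2014, proof of Theorem 3.1].  We avoid infinite sums in `MvPowerSeries` and verify the
equivalent statement coefficient by coefficient: writing the summands through the trinomial kernel
`T(a,b,k) = C(a,k)·C(a+b−k,a) = (a+b−k; a−k, b−k, k)` (the `λ_j = 2` block coefficient of
`(x₁x₂)^k (1 − x₁ − x₂)^{-(k+1)}`), the identity `D · F = 1` says that the coefficients satisfy the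
linear recurrence dictated by the monomials of the denominator `D`, with right-hand side `[𝐧 = 0]`.
That recurrence follows from two Pascal-type rules: the trinomial rule
`T(a+1,b+1,k+1) = T(a,b+1,k+1) + T(a+1,b,k+1) + T(a,b,k)` (which encodes
`(1 − x₁ − x₂ − y·x₁x₂)^{-1} = Σ T(a,b,k) x₁^a x₂^b y^k`) and the binomial rule for `C(n₃,k)`
(encoding `Σ_n C(n,k) x^n = x^k (1−x)^{-(k+1)}`), together with the boundary values
`T(a,b,0) = C(a+b,a)`, `T(0,b,k+1) = T(a,0,k+1) = 0`.  Sections 1–2 prove these finite identities over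
`ℤ`; Sections 3–4 extract the coefficients of `D · F` with `MvPowerSeries.coeff_monomial_mul` and
conclude.  (Sections 1–2 are written for an arbitrary kernel `t` satisfying the four displayed rules, as
section hypotheses; Section 2c instantiates them with `T`.  The file declares theorems only.)

## References

* [Straub2014] A. Straub, *Multivariate Apéry numbers and supercongruences of rational functions*,
  Algebra & Number Theory 8 (2014) 1985–2008, Theorem 1.1, (7)–(8), Theorem 3.1, Example 3.4 (24).
-/

open Finset

namespace Literature.Combinatorics.Enumerative.MultivariateAperyNumbers

/-! ### §1 The trinomial kernel `T(a,b,k) = C(a,k)·C(a+b−k,a)` and its Pascal rule -/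

/-- `T(a,b,k) = C(a,k)·C(a+b−k,a)` vanishes for `k > a`. [folklore] -/
private theorem T_eq_zero_of_lt {a b k : ℕ} (h : a < k) :
    ((a.choose k * (a + b - k).choose a : ℕ) : ℤ) = 0 := by
  simp [Nat.choose_eq_zero_of_lt h]

/-- `T(a,b,0) = C(a+b,a)`. [folklore] -/
private theorem T_zero (a b : ℕ) :
    ((a.choose 0 * (a + b - 0).choose a : ℕ) : ℤ) = (((a + b).choose a : ℕ) : ℤ) := by
  simp

/-- `T(a,0,k+1) = 0` (for `k+1 ≤ a` the second factor is `C(a−k−1,a) = 0`). [folklore] -/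
private theorem T_zero_right_succ (a k : ℕ) :
    ((a.choose (k + 1) * (a + 0 - (k + 1)).choose a : ℕ) : ℤ) = 0 := by
  rcases lt_or_ge a (k + 1) with h | h
  · simp [Nat.choose_eq_zero_of_lt h]
  · have h' : a - (k + 1) < a := by omega
    simp [Nat.choose_eq_zero_of_lt h']

/-- The trinomial Pascal rule `T(a+1,b+1,k+1) = T(a,b+1,k+1) + T(a+1,b,k+1) + T(a,b,k)` (two binomial
Pascal rules multiplied out). [folklore] -/
private theorem T_pascal (a b k : ℕ) :
    (((a + 1).choose (k + 1) * (a + 1 + (b + 1) - (k + 1)).choose (a + 1) : ℕ) : ℤ) =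
      ((a.choose (k + 1) * (a + (b + 1) - (k + 1)).choose a : ℕ) : ℤ)
        + (((a + 1).choose (k + 1) * (a + 1 + b - (k + 1)).choose (a + 1) : ℕ) : ℤ)
        + ((a.choose k * (a + b - k).choose a : ℕ) : ℤ) := by
  rcases lt_or_ge a k with h | h
  · rw [Nat.choose_eq_zero_of_lt (by omega : a + 1 < k + 1), Nat.choose_eq_zero_of_lt (by omega : a < k + 1),
      Nat.choose_eq_zero_of_lt h]
    simp
  · have e1 : a + 1 + (b + 1) - (k + 1) = (a + b - k) + 1 := by omega
    have e2 : a + (b + 1) - (k + 1) = a + b - k := by omega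
    have e3 : a + 1 + b - (k + 1) = a + b - k := by omega
    rw [e1, e2, e3, Nat.choose_succ_succ' (a + b - k) a, Nat.choose_succ_succ' a k]
    push_cast
    ring

/-! ### §2 Weighted kernel sums `Σ_{k ≤ a} t(a,b,k)·g(k)` for an abstract kernel `t`

Throughout this section `t : ℕ → ℕ → ℕ → ℤ` is any kernel satisfying the four rules proved for `T` in §1
(vanishing above the diagonal, value at `k = 0`, vanishing of `t(a,0,k+1)`, trinomial Pascal rule). -/

section Kernel

variable (t : ℕ → ℕ → ℕ → ℤ)
  (ht_lt : ∀ {a b k : ℕ}, a < k → t a b k = 0)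
  (ht_zero : ∀ a b : ℕ, t a b 0 = (((a + b).choose a : ℕ) : ℤ))
  (ht_right : ∀ a k : ℕ, t a 0 (k + 1) = 0)
  (ht_pascal : ∀ a b k : ℕ,
    t (a + 1) (b + 1) (k + 1) = t a (b + 1) (k + 1) + t (a + 1) b (k + 1) + t a b k)

include ht_lt in
/-- Extending the summation range past `a` adds only zero terms. [folklore] -/
private theorem sum_kernel_range_add (a b d : ℕ) (g : ℕ → ℤ) :
    ∑ k ∈ range (a + 1 + d), t a b k * g k = ∑ k ∈ range (a + 1), t a b k * g k := by
  induction d with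
  | zero => rfl
  | succ d ih =>
    rw [← add_assoc, Finset.sum_range_succ, ih, ht_lt (by omega), zero_mul, add_zero]

include ht_lt in
/-- Extending the summation range of the shifted sum past `a` adds only zero terms. [folklore] -/
private theorem sum_kernel_succ_range_add (a b d : ℕ) (g : ℕ → ℤ) :
    ∑ j ∈ range (a + 1 + d), t a b (j + 1) * g j = ∑ j ∈ range (a + 1), t a b (j + 1) * g j := by
  induction d with
  | zero => rfl
  | succ d ih =>
    rw [← add_assoc, Finset.sum_range_succ, ih, ht_lt (by omega), zero_mul, add_zero]

include ht_lt in
/-- The last term of the shifted sum vanishes. [folklore] -/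
private theorem sum_kernel_succ_eq_sum_range (a b : ℕ) (g : ℕ → ℤ) :
    ∑ j ∈ range (a + 1), t a b (j + 1) * g j = ∑ j ∈ range a, t a b (j + 1) * g j := by
  rw [Finset.sum_range_succ, ht_lt (by omega), zero_mul, add_zero]

include ht_zero in
/-- A weight concentrated at `k = 0` sees only `t(a,b,0) = C(a+b,a)`. [folklore] -/
private theorem sum_kernel_of_weight_succ_eq_zero (a b : ℕ) (g : ℕ → ℤ) (hg : ∀ j, g (j + 1) = 0) :
    ∑ k ∈ range (a + 1), t a b k * g k = (((a + b).choose a : ℕ) : ℤ) * g 0 := by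
  rw [Finset.sum_range_succ', ht_zero]
  simp [hg]

include ht_lt in
/-- The shifted sum vanishes for `a = 0`. [folklore] -/
private theorem sum_kernel_succ_zero_left (b : ℕ) (g : ℕ → ℤ) :
    ∑ j ∈ range (0 + 1), t 0 b (j + 1) * g j = 0 := by
  simp [ht_lt (Nat.succ_pos _)]

include ht_right in
/-- The shifted sum vanishes for `b = 0`. [folklore] -/
private theorem sum_kernel_succ_zero_right (a : ℕ) (g : ℕ → ℤ) :
    ∑ j ∈ range (a + 1), t a 0 (j + 1) * g j = 0 := by
  simp [ht_right]

include ht_lt in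
/-- Difference rule: if the weights satisfy `g₁(j+1) − g₂(j+1) = g(j)` and `g₁(0) = g₂(0)`, then
`Σ t(a,b,k) g₁(k) − Σ t(a,b,k) g₂(k) = Σ t(a,b,j+1) g(j)`. [folklore] -/
private theorem sum_kernel_sub_of_weights (a b : ℕ) (g₁ g₂ g : ℕ → ℤ) (h0 : g₁ 0 = g₂ 0)
    (hs : ∀ j, g₁ (j + 1) - g₂ (j + 1) = g j) :
    ∑ k ∈ range (a + 1), t a b k * g₁ k - ∑ k ∈ range (a + 1), t a b k * g₂ k =
      ∑ j ∈ range (a + 1), t a b (j + 1) * g j := by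
  rw [sum_kernel_succ_eq_sum_range t ht_lt, ← Finset.sum_sub_distrib, Finset.sum_range_succ']
  simp only [← mul_sub, hs, h0, sub_self, add_zero]

include ht_lt ht_pascal in
/-- The trinomial Pascal rule summed against a weight:
`Σ t(a+1,b+1,j+1)g(j) − Σ t(a,b+1,j+1)g(j) − Σ t(a+1,b,j+1)g(j) = Σ t(a,b,k)g(k)`. [folklore] -/
private theorem sum_kernel_pascal (a b : ℕ) (g : ℕ → ℤ) :
    ∑ j ∈ range (a + 1 + 1), t (a + 1) (b + 1) (j + 1) * g j
      - ∑ j ∈ range (a + 1), t a (b + 1) (j + 1) * g j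
      - ∑ j ∈ range (a + 1 + 1), t (a + 1) b (j + 1) * g j = ∑ k ∈ range (a + 1), t a b k * g k := by
  have h1 : ∑ j ∈ range (a + 1 + 1), t (a + 1) (b + 1) (j + 1) * g j =
      ∑ j ∈ range (a + 1 + 1),
        (t a (b + 1) (j + 1) * g j + t (a + 1) b (j + 1) * g j + t a b j * g j) := by
    refine Finset.sum_congr rfl fun j _ => ?_
    rw [ht_pascal]; ring
  rw [h1, Finset.sum_add_distrib, Finset.sum_add_distrib, sum_kernel_succ_range_add t ht_lt a (b + 1) 1 g,
    sum_kernel_range_add t ht_lt a b 1 g]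
  ring

/-! ### §2a Three variables: `B(a,b,c) = Σ_k t(a,b,k) C(c,k)` and `B'(a,b,c) = Σ_j t(a,b,j+1) C(c,j)` -/

include ht_lt in
/-- The binomial Pascal rule in the third variable: `B(a,b,c+1) − B(a,b,c) = B'(a,b,c)`. [folklore] -/
private theorem kernelB_succ_sub (a b c : ℕ) :
    ∑ k ∈ range (a + 1), t a b k * (((c + 1).choose k : ℕ) : ℤ)
      - ∑ k ∈ range (a + 1), t a b k * ((c.choose k : ℕ) : ℤ) =
      ∑ j ∈ range (a + 1), t a b (j + 1) * ((c.choose j : ℕ) : ℤ) :=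
  sum_kernel_sub_of_weights t ht_lt a b _ _ _ (by simp) fun j => by
    rw [Nat.choose_succ_succ']; push_cast; ring

include ht_zero in
/-- `B(a,b,0) = C(a+b,a)`. [folklore] -/
private theorem kernelB_zero (a b : ℕ) :
    ∑ k ∈ range (a + 1), t a b k * (((0 : ℕ).choose k : ℕ) : ℤ) = (((a + b).choose a : ℕ) : ℤ) := by
  rw [sum_kernel_of_weight_succ_eq_zero t ht_zero a b _ fun j => by simp]
  simp

/-- The boundary Pascal rule `C(a+b,a) − [a ≥ 1] C(a−1+b,a−1) − [b ≥ 1] C(a+b−1,a) = [a = b = 0]`.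
[folklore] -/
private theorem choose_delta (a b : ℕ) :
    (((a + b).choose a : ℕ) : ℤ) - (if 1 ≤ a then (((a - 1 + b).choose (a - 1) : ℕ) : ℤ) else 0)
      - (if 1 ≤ b then (((a + (b - 1)).choose a : ℕ) : ℤ) else 0) =
      if a = 0 ∧ b = 0 then 1 else 0 := by
  rcases a with _ | a <;> rcases b with _ | b
  · simp
  · simp
  · simp
  · have e : a + 1 + (b + 1) = (a + (b + 1)) + 1 := by omega
    simp only [le_add_iff_nonneg_left, zero_le, ↓reduceIte, Nat.add_sub_cancel, add_eq_zero,
      one_ne_zero, and_false, and_self, e, Nat.choose_succ_succ' (a + (b + 1)) a]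
    have e2 : a + (b + 1) = a + 1 + b := by omega
    rw [e2]
    push_cast
    ring

include ht_lt ht_zero ht_right ht_pascal in
/-- The coefficient identity behind Example 3.4 (24), for an abstract kernel: the numbers
`B(a,b,c) = Σ_k t(a,b,k) C(c,k)` satisfy the recurrence of the denominator
`1 − x₁ − x₂ − x₃ + x₁x₃ + x₂x₃ − x₁x₂x₃` with right-hand side `[𝐧 = 0]`. [folklore] -/
private theorem kernel_coeff_identity_B (a b c : ℕ) :
    ∑ k ∈ range (a + 1), t a b k * ((c.choose k : ℕ) : ℤ)
      - (if 1 ≤ a then ∑ k ∈ range (a - 1 + 1), t (a - 1) b k * ((c.choose k : ℕ) : ℤ) else 0)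
      - (if 1 ≤ b then ∑ k ∈ range (a + 1), t a (b - 1) k * ((c.choose k : ℕ) : ℤ) else 0)
      - (if 1 ≤ c then ∑ k ∈ range (a + 1), t a b k * (((c - 1).choose k : ℕ) : ℤ) else 0)
      + (if 1 ≤ a ∧ 1 ≤ c then
          ∑ k ∈ range (a - 1 + 1), t (a - 1) b k * (((c - 1).choose k : ℕ) : ℤ) else 0)
      + (if 1 ≤ b ∧ 1 ≤ c then
          ∑ k ∈ range (a + 1), t a (b - 1) k * (((c - 1).choose k : ℕ) : ℤ) else 0)
      - (if 1 ≤ a ∧ 1 ≤ b ∧ 1 ≤ c then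
          ∑ k ∈ range (a - 1 + 1), t (a - 1) (b - 1) k * (((c - 1).choose k : ℕ) : ℤ) else 0) =
      if a = 0 ∧ b = 0 ∧ c = 0 then 1 else 0 := by
  rcases c with _ | c
  · -- `c = 0`: only the binomials `C(a+b,a)` survive
    have h := choose_delta a b
    simp only [kernelB_zero t ht_zero, nonpos_iff_eq_zero, one_ne_zero, and_false, ↓reduceIte, sub_zero,
      add_zero, and_true] at h ⊢
    exact h
  · have hc : (1 : ℕ) ≤ c + 1 := by omega
    simp only [hc, and_true, ↓reduceIte, Nat.add_sub_cancel, add_eq_zero, one_ne_zero, and_false]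
    rcases a with _ | a <;> rcases b with _ | b
    · have h := kernelB_succ_sub t ht_lt 0 0 c
      rw [sum_kernel_succ_zero_left t ht_lt] at h
      simp only [nonpos_iff_eq_zero, one_ne_zero, ↓reduceIte, and_self]
      linarith
    · have h := kernelB_succ_sub t ht_lt 0 (b + 1) c
      have h' := kernelB_succ_sub t ht_lt 0 b c
      rw [sum_kernel_succ_zero_left t ht_lt] at h h'
      simp only [nonpos_iff_eq_zero, one_ne_zero, ↓reduceIte, le_add_iff_nonneg_left, zero_le,
        Nat.add_sub_cancel, false_and]
      linarith
    · have h := kernelB_succ_sub t ht_lt (a + 1) 0 c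
      have h' := kernelB_succ_sub t ht_lt a 0 c
      rw [sum_kernel_succ_zero_right t ht_right] at h h'
      simp only [le_add_iff_nonneg_left, zero_le, ↓reduceIte, Nat.add_sub_cancel, nonpos_iff_eq_zero,
        one_ne_zero, and_false]
      linarith
    · have h₁ := kernelB_succ_sub t ht_lt (a + 1) (b + 1) c
      have h₂ := kernelB_succ_sub t ht_lt a (b + 1) c
      have h₃ := kernelB_succ_sub t ht_lt (a + 1) b c
      have hp := sum_kernel_pascal t ht_lt ht_pascal a b fun k => ((c.choose k : ℕ) : ℤ)
      simp only [le_add_iff_nonneg_left, zero_le, ↓reduceIte, Nat.add_sub_cancel, and_self]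
      linarith

/-! ### §2b Four variables: `A(𝐧) = Σ_k t(n₁,n₂,k) t(n₃,n₄,k)` and `A'(𝐧) = Σ_j t(n₁,n₂,j+1) t(n₃,n₄,j)` -/

include ht_lt ht_zero ht_pascal in
/-- The `(x₃,x₄)`-pair rule: `A(·,n₃+1,n₄+1) − A(·,n₃,n₄+1) − A(·,n₃+1,n₄) = A'(·,n₃,n₄)`. [folklore] -/
private theorem kernelA_pair (n₁ n₂ n₃ n₄ : ℕ) :
    ∑ k ∈ range (n₁ + 1), t n₁ n₂ k * t (n₃ + 1) (n₄ + 1) k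
      - ∑ k ∈ range (n₁ + 1), t n₁ n₂ k * t n₃ (n₄ + 1) k
      - ∑ k ∈ range (n₁ + 1), t n₁ n₂ k * t (n₃ + 1) n₄ k =
      ∑ j ∈ range (n₁ + 1), t n₁ n₂ (j + 1) * t n₃ n₄ j := by
  have h := sum_kernel_sub_of_weights t ht_lt n₁ n₂ (fun k => t (n₃ + 1) (n₄ + 1) k)
    (fun k => t n₃ (n₄ + 1) k + t (n₃ + 1) n₄ k) (fun k => t n₃ n₄ k) ?_ ?_
  · have hadd : ∑ k ∈ range (n₁ + 1), t n₁ n₂ k * (t n₃ (n₄ + 1) k + t (n₃ + 1) n₄ k) =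
        ∑ k ∈ range (n₁ + 1), t n₁ n₂ k * t n₃ (n₄ + 1) k
          + ∑ k ∈ range (n₁ + 1), t n₁ n₂ k * t (n₃ + 1) n₄ k := by
      rw [← Finset.sum_add_distrib]
      refine Finset.sum_congr rfl fun k _ => ?_
      ring
    simp only [hadd] at h
    linarith
  · simp only [ht_zero]
    have e : n₃ + 1 + (n₄ + 1) = (n₃ + (n₄ + 1)) + 1 := by omega
    have e2 : n₃ + 1 + n₄ = n₃ + (n₄ + 1) := by omega
    rw [e, e2, Nat.choose_succ_succ' (n₃ + (n₄ + 1)) n₃]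
    push_cast
    ring
  · intro j
    simp only [ht_pascal]
    ring

include ht_zero ht_lt in
/-- `A(n₁,n₂,0,n₄) = C(n₁+n₂,n₁)`. [folklore] -/
private theorem kernelA_third_zero (n₁ n₂ n₄ : ℕ) :
    ∑ k ∈ range (n₁ + 1), t n₁ n₂ k * t 0 n₄ k = (((n₁ + n₂).choose n₁ : ℕ) : ℤ) := by
  rw [sum_kernel_of_weight_succ_eq_zero t ht_zero n₁ n₂ _ fun j => ht_lt (Nat.succ_pos j), ht_zero]
  simp

include ht_zero ht_right in
/-- `A(n₁,n₂,n₃,0) = C(n₁+n₂,n₁)`. [folklore] -/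
private theorem kernelA_fourth_zero (n₁ n₂ n₃ : ℕ) :
    ∑ k ∈ range (n₁ + 1), t n₁ n₂ k * t n₃ 0 k = (((n₁ + n₂).choose n₁ : ℕ) : ℤ) := by
  rw [sum_kernel_of_weight_succ_eq_zero t ht_zero n₁ n₂ _ fun j => ht_right n₃ j, ht_zero]
  simp

include ht_lt ht_zero ht_right ht_pascal in
/-- The coefficient identity behind Theorem 1.1, for an abstract kernel: the numbers
`A(𝐧) = Σ_k t(n₁,n₂,k) t(n₃,n₄,k)` satisfy the recurrence of the denominator
`(1 − x₁ − x₂)(1 − x₃ − x₄) − x₁x₂x₃x₄` with right-hand side `[𝐧 = 0]`. [folklore] -/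
private theorem kernel_coeff_identity_A (n₁ n₂ n₃ n₄ : ℕ) :
    ∑ k ∈ range (n₁ + 1), t n₁ n₂ k * t n₃ n₄ k
      - (if 1 ≤ n₁ then ∑ k ∈ range (n₁ - 1 + 1), t (n₁ - 1) n₂ k * t n₃ n₄ k else 0)
      - (if 1 ≤ n₂ then ∑ k ∈ range (n₁ + 1), t n₁ (n₂ - 1) k * t n₃ n₄ k else 0)
      - (if 1 ≤ n₃ then ∑ k ∈ range (n₁ + 1), t n₁ n₂ k * t (n₃ - 1) n₄ k else 0)
      - (if 1 ≤ n₄ then ∑ k ∈ range (n₁ + 1), t n₁ n₂ k * t n₃ (n₄ - 1) k else 0)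
      + (if 1 ≤ n₁ ∧ 1 ≤ n₃ then
          ∑ k ∈ range (n₁ - 1 + 1), t (n₁ - 1) n₂ k * t (n₃ - 1) n₄ k else 0)
      + (if 1 ≤ n₁ ∧ 1 ≤ n₄ then
          ∑ k ∈ range (n₁ - 1 + 1), t (n₁ - 1) n₂ k * t n₃ (n₄ - 1) k else 0)
      + (if 1 ≤ n₂ ∧ 1 ≤ n₃ then
          ∑ k ∈ range (n₁ + 1), t n₁ (n₂ - 1) k * t (n₃ - 1) n₄ k else 0)
      + (if 1 ≤ n₂ ∧ 1 ≤ n₄ then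
          ∑ k ∈ range (n₁ + 1), t n₁ (n₂ - 1) k * t n₃ (n₄ - 1) k else 0)
      - (if 1 ≤ n₁ ∧ 1 ≤ n₂ ∧ 1 ≤ n₃ ∧ 1 ≤ n₄ then
          ∑ k ∈ range (n₁ - 1 + 1), t (n₁ - 1) (n₂ - 1) k * t (n₃ - 1) (n₄ - 1) k else 0) =
      if n₁ = 0 ∧ n₂ = 0 ∧ n₃ = 0 ∧ n₄ = 0 then 1 else 0 := by
  rcases n₃ with _ | n₃
  · -- `n₃ = 0`: `A(n₁,n₂,0,n₄) = C(n₁+n₂,n₁)` for every `n₄`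
    have h := choose_delta n₁ n₂
    rcases n₄ with _ | n₄
    · simp only [kernelA_third_zero t ht_lt ht_zero, nonpos_iff_eq_zero, one_ne_zero, and_false,
        ↓reduceIte, sub_zero, add_zero, and_true] at h ⊢
      exact h
    · simp only [kernelA_third_zero t ht_lt ht_zero, nonpos_iff_eq_zero, one_ne_zero, and_false,
        ↓reduceIte, sub_zero, add_zero, le_add_iff_nonneg_left, zero_le, and_true, Nat.add_sub_cancel,
        add_eq_zero]
      ring
  · rcases n₄ with _ | n₄
    · -- `n₄ = 0`, `n₃ ≥ 1`
      simp only [kernelA_fourth_zero t ht_zero ht_right, le_add_iff_nonneg_left, zero_le, ↓reduceIte,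
        Nat.add_sub_cancel, nonpos_iff_eq_zero, one_ne_zero, and_false, sub_zero, add_zero,
        add_eq_zero, and_true]
      ring
    · -- `n₃, n₄ ≥ 1`: the pair rule in `(x₃,x₄)`, then the Pascal rule in `(x₁,x₂)`
      have h34 : (1 : ℕ) ≤ n₃ + 1 := by omega
      have h44 : (1 : ℕ) ≤ n₄ + 1 := by omega
      simp only [h34, h44, and_true, and_self, ↓reduceIte, Nat.add_sub_cancel, add_eq_zero,
        one_ne_zero, and_false]
      rcases n₁ with _ | n₁ <;> rcases n₂ with _ | n₂
      · have h := kernelA_pair t ht_lt ht_zero ht_pascal 0 0 n₃ n₄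
        rw [sum_kernel_succ_zero_left t ht_lt] at h
        simp only [nonpos_iff_eq_zero, one_ne_zero, ↓reduceIte, and_self]
        linarith
      · have h := kernelA_pair t ht_lt ht_zero ht_pascal 0 (n₂ + 1) n₃ n₄
        have h' := kernelA_pair t ht_lt ht_zero ht_pascal 0 n₂ n₃ n₄
        rw [sum_kernel_succ_zero_left t ht_lt] at h h'
        simp only [nonpos_iff_eq_zero, one_ne_zero, ↓reduceIte, le_add_iff_nonneg_left, zero_le,
          Nat.add_sub_cancel, false_and]
        linarith
      · have h := kernelA_pair t ht_lt ht_zero ht_pascal (n₁ + 1) 0 n₃ n₄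
        have h' := kernelA_pair t ht_lt ht_zero ht_pascal n₁ 0 n₃ n₄
        rw [sum_kernel_succ_zero_right t ht_right] at h h'
        simp only [le_add_iff_nonneg_left, zero_le, ↓reduceIte, Nat.add_sub_cancel,
          nonpos_iff_eq_zero, one_ne_zero, and_false]
        linarith
      · have h₁ := kernelA_pair t ht_lt ht_zero ht_pascal (n₁ + 1) (n₂ + 1) n₃ n₄
        have h₂ := kernelA_pair t ht_lt ht_zero ht_pascal n₁ (n₂ + 1) n₃ n₄
        have h₃ := kernelA_pair t ht_lt ht_zero ht_pascal (n₁ + 1) n₂ n₃ n₄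
        have h₄ := kernelA_pair t ht_lt ht_zero ht_pascal n₁ n₂ n₃ n₄
        have hp := sum_kernel_pascal t ht_lt ht_pascal n₁ n₂ fun k => t n₃ n₄ k
        simp only [le_add_iff_nonneg_left, zero_le, ↓reduceIte, Nat.add_sub_cancel, and_self]
        linarith

end Kernel

/-! ### §2c The identities for `straubB` and `straubA` -/

/-- `straubB` cast to `ℤ`, written through the kernel `T`. [folklore] -/
private theorem straubB_cast (a b c : ℕ) :
    ((straubB a b c : ℕ) : ℤ) =
      ∑ k ∈ range (a + 1), ((a.choose k * (a + b - k).choose a : ℕ) : ℤ) * ((c.choose k : ℕ) : ℤ) := by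
  unfold straubB
  push_cast
  rfl

/-- `straubA` cast to `ℤ`, written through the kernel `T`. [folklore] -/
private theorem straubA_cast (n₁ n₂ n₃ n₄ : ℕ) :
    ((straubA n₁ n₂ n₃ n₄ : ℕ) : ℤ) =
      ∑ k ∈ range (n₁ + 1), ((n₁.choose k * (n₁ + n₂ - k).choose n₁ : ℕ) : ℤ) *
        ((n₃.choose k * (n₃ + n₄ - k).choose n₃ : ℕ) : ℤ) := by
  unfold straubA
  push_cast
  refine Finset.sum_congr rfl fun k _ => ?_
  ring

/-- The coefficient identity behind Example 3.4 (24): the numbers `straubB` satisfy the recurrence of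
`1 − x₁ − x₂ − x₃ + x₁x₃ + x₂x₃ − x₁x₂x₃` with right-hand side `[𝐧 = 0]`. [folklore] -/
private theorem coeff_identity_B (a b c : ℕ) :
    ((straubB a b c : ℕ) : ℤ) - (if 1 ≤ a then ((straubB (a - 1) b c : ℕ) : ℤ) else 0)
      - (if 1 ≤ b then ((straubB a (b - 1) c : ℕ) : ℤ) else 0)
      - (if 1 ≤ c then ((straubB a b (c - 1) : ℕ) : ℤ) else 0)
      + (if 1 ≤ a ∧ 1 ≤ c then ((straubB (a - 1) b (c - 1) : ℕ) : ℤ) else 0)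
      + (if 1 ≤ b ∧ 1 ≤ c then ((straubB a (b - 1) (c - 1) : ℕ) : ℤ) else 0)
      - (if 1 ≤ a ∧ 1 ≤ b ∧ 1 ≤ c then ((straubB (a - 1) (b - 1) (c - 1) : ℕ) : ℤ) else 0) =
      if a = 0 ∧ b = 0 ∧ c = 0 then 1 else 0 := by
  have key := kernel_coeff_identity_B (fun a b k => ((a.choose k * (a + b - k).choose a : ℕ) : ℤ))
    (fun h => T_eq_zero_of_lt h) T_zero T_zero_right_succ T_pascal a b c
  simpa only [straubB_cast] using key

/-- The coefficient identity behind Theorem 1.1: the numbers `straubA` satisfy the recurrence of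
`(1 − x₁ − x₂)(1 − x₃ − x₄) − x₁x₂x₃x₄` with right-hand side `[𝐧 = 0]`. [folklore] -/
private theorem coeff_identity_A (n₁ n₂ n₃ n₄ : ℕ) :
    ((straubA n₁ n₂ n₃ n₄ : ℕ) : ℤ)
      - (if 1 ≤ n₁ then ((straubA (n₁ - 1) n₂ n₃ n₄ : ℕ) : ℤ) else 0)
      - (if 1 ≤ n₂ then ((straubA n₁ (n₂ - 1) n₃ n₄ : ℕ) : ℤ) else 0)
      - (if 1 ≤ n₃ then ((straubA n₁ n₂ (n₃ - 1) n₄ : ℕ) : ℤ) else 0)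
      - (if 1 ≤ n₄ then ((straubA n₁ n₂ n₃ (n₄ - 1) : ℕ) : ℤ) else 0)
      + (if 1 ≤ n₁ ∧ 1 ≤ n₃ then ((straubA (n₁ - 1) n₂ (n₃ - 1) n₄ : ℕ) : ℤ) else 0)
      + (if 1 ≤ n₁ ∧ 1 ≤ n₄ then ((straubA (n₁ - 1) n₂ n₃ (n₄ - 1) : ℕ) : ℤ) else 0)
      + (if 1 ≤ n₂ ∧ 1 ≤ n₃ then ((straubA n₁ (n₂ - 1) (n₃ - 1) n₄ : ℕ) : ℤ) else 0)
      + (if 1 ≤ n₂ ∧ 1 ≤ n₄ then ((straubA n₁ (n₂ - 1) n₃ (n₄ - 1) : ℕ) : ℤ) else 0)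
      - (if 1 ≤ n₁ ∧ 1 ≤ n₂ ∧ 1 ≤ n₃ ∧ 1 ≤ n₄ then
          ((straubA (n₁ - 1) (n₂ - 1) (n₃ - 1) (n₄ - 1) : ℕ) : ℤ) else 0) =
      if n₁ = 0 ∧ n₂ = 0 ∧ n₃ = 0 ∧ n₄ = 0 then 1 else 0 := by
  have key := kernel_coeff_identity_A (fun a b k => ((a.choose k * (a + b - k).choose a : ℕ) : ℤ))
    (fun h => T_eq_zero_of_lt h) T_zero T_zero_right_succ T_pascal n₁ n₂ n₃ n₄
  simpa only [straubA_cast] using key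

/-! ### §3 Coefficient extraction in `MvPowerSeries` -/

section Coefficients

open MvPowerSeries Finsupp

/-- Coordinatewise order on `Fin 3 →₀ ℕ`. [folklore] -/
private theorem le_iff_fin3 (f g : Fin 3 →₀ ℕ) : f ≤ g ↔ f 0 ≤ g 0 ∧ f 1 ≤ g 1 ∧ f 2 ≤ g 2 := by
  constructor
  · intro h; exact ⟨h 0, h 1, h 2⟩
  · rintro ⟨h0, h1, h2⟩ i
    fin_cases i
    · exact h0
    · exact h1
    · exact h2

/-- A finitely supported function on `Fin 3` vanishes iff its three values do. [folklore] -/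
private theorem eq_zero_iff_fin3 (f : Fin 3 →₀ ℕ) : f = 0 ↔ f 0 = 0 ∧ f 1 = 0 ∧ f 2 = 0 := by
  constructor
  · rintro rfl; simp
  · rintro ⟨h0, h1, h2⟩
    ext i
    fin_cases i
    · exact h0
    · exact h1
    · exact h2

/-- Coordinatewise order on `Fin 4 →₀ ℕ`. [folklore] -/
private theorem le_iff_fin4 (f g : Fin 4 →₀ ℕ) :
    f ≤ g ↔ f 0 ≤ g 0 ∧ f 1 ≤ g 1 ∧ f 2 ≤ g 2 ∧ f 3 ≤ g 3 := by
  constructor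
  · intro h; exact ⟨h 0, h 1, h 2, h 3⟩
  · rintro ⟨h0, h1, h2, h3⟩ i
    fin_cases i
    · exact h0
    · exact h1
    · exact h2
    · exact h3

/-- A finitely supported function on `Fin 4` vanishes iff its four values do. [folklore] -/
private theorem eq_zero_iff_fin4 (f : Fin 4 →₀ ℕ) :
    f = 0 ↔ f 0 = 0 ∧ f 1 = 0 ∧ f 2 = 0 ∧ f 3 = 0 := by
  constructor
  · rintro rfl; simp
  · rintro ⟨h0, h1, h2, h3⟩
    ext i
    fin_cases i
    · exact h0
    · exact h1
    · exact h2
    · exact h3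

/-- The coefficients of `straubSeriesB` are the numbers `straubB`. [folklore] -/
private theorem coeff_straubSeriesB (m : Fin 3 →₀ ℕ) :
    MvPowerSeries.coeff m straubSeriesB = ((straubB (m 0) (m 1) (m 2) : ℕ) : ℤ) := rfl

/-- The coefficients of `straubSeriesA` are the numbers `straubA`. [folklore] -/
private theorem coeff_straubSeriesA (m : Fin 4 →₀ ℕ) :
    MvPowerSeries.coeff m straubSeriesA = ((straubA (m 0) (m 1) (m 2) (m 3) : ℕ) : ℤ) := rfl

/-- The denominator of (24) as a signed sum of monomials of `ℤ⟦x₁,x₂,x₃⟧`. [folklore] -/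
private theorem straubDenomB_coe_eq :
    (straubDenomB : MvPowerSeries (Fin 3) ℤ) =
      1 - monomial (single 0 1) 1 - monomial (single 1 1) 1 - monomial (single 2 1) 1
        + monomial (single 0 1 + single 2 1) 1 + monomial (single 1 1 + single 2 1) 1
        - monomial (single 0 1 + single 1 1 + single 2 1) 1 := by
  have h : (straubDenomB : MvPowerSeries (Fin 3) ℤ) =
      (1 - X 0 - X 1) * (1 - X 2) - X 0 * X 1 * X 2 := by
    unfold straubDenomB
    rw [← MvPolynomial.coeToMvPowerSeries.ringHom_apply]
    simp only [map_sub, map_mul, map_one, MvPolynomial.coeToMvPowerSeries.ringHom_apply,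
      MvPolynomial.coe_X]
  rw [h]
  have e : ((1 - X 0 - X 1) * (1 - X 2) - X 0 * X 1 * X 2 : MvPowerSeries (Fin 3) ℤ) =
      1 - X 0 - X 1 - X 2 + X 0 * X 2 + X 1 * X 2 - X 0 * X 1 * X 2 := by ring
  rw [e]
  simp only [X_def, monomial_mul_monomial, mul_one]

/-- The denominator of (6) as a signed sum of monomials of `ℤ⟦x₁,…,x₄⟧`. [folklore] -/
private theorem straubDenomA_coe_eq :
    (straubDenomA : MvPowerSeries (Fin 4) ℤ) =
      1 - monomial (single 0 1) 1 - monomial (single 1 1) 1 - monomial (single 2 1) 1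
        - monomial (single 3 1) 1
        + monomial (single 0 1 + single 2 1) 1 + monomial (single 0 1 + single 3 1) 1
        + monomial (single 1 1 + single 2 1) 1 + monomial (single 1 1 + single 3 1) 1
        - monomial (single 0 1 + single 1 1 + single 2 1 + single 3 1) 1 := by
  have h : (straubDenomA : MvPowerSeries (Fin 4) ℤ) =
      (1 - X 0 - X 1) * (1 - X 2 - X 3) - X 0 * X 1 * X 2 * X 3 := by
    unfold straubDenomA
    rw [← MvPolynomial.coeToMvPowerSeries.ringHom_apply]
    simp only [map_sub, map_mul, map_one, MvPolynomial.coeToMvPowerSeries.ringHom_apply,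
      MvPolynomial.coe_X]
  rw [h]
  have e : ((1 - X 0 - X 1) * (1 - X 2 - X 3) - X 0 * X 1 * X 2 * X 3 : MvPowerSeries (Fin 4) ℤ) =
      1 - X 0 - X 1 - X 2 - X 3 + X 0 * X 2 + X 0 * X 3 + X 1 * X 2 + X 1 * X 3
        - X 0 * X 1 * X 2 * X 3 := by ring
  rw [e]
  simp only [X_def, monomial_mul_monomial, mul_one]

end Coefficients

/-! ### §4 The discharges -/

section Discharges

open MvPowerSeries Finsupp

/-- **Straub 2014, Example 3.4, (24)** — PROVED: `((1 − x₁ − x₂)(1 − x₃) − x₁x₂x₃) · Σ_{𝐧 ≥ 0} B(𝐧) 𝐱^𝐧 = 1`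
in `ℤ⟦x₁,x₂,x₃⟧`, where `B(n₁,n₂,n₃) = Σ_k C(n₁,k) C(n₁+n₂−k,n₁) C(n₃,k)` are the `λ = (2,1)`, `ε = 1`
numbers of Theorem 3.1; with `straubB_diag`, Apéry's `ζ(2)` numbers are the diagonal Taylor coefficients
of `1/((1 − x₁ − x₂)(1 − x₃) − x₁x₂x₃)`.  Discharges the named fact `example34_genFun`.
[cite: Straub2014, Example 3.4 (24); Theorem 3.1] -/
theorem example34_genFun_holds : example34_genFun := by
  classical
  unfold example34_genFun
  rw [straubDenomB_coe_eq]
  ext m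
  simp only [sub_mul, add_mul, one_mul, map_sub, map_add, coeff_monomial_mul, coeff_straubSeriesB,
    MvPowerSeries.coeff_one, le_iff_fin3, eq_zero_iff_fin3, Finsupp.tsub_apply, Finsupp.add_apply,
    Finsupp.single_apply]
  simp only [Fin.isValue, ↓reduceIte, zero_le, true_and, and_true, add_zero, zero_add, tsub_zero,
    show ((0 : Fin 3) = 2) = False by decide, show ((2 : Fin 3) = 0) = False by decide,
    show ((1 : Fin 3) = 2) = False by decide, show ((2 : Fin 3) = 1) = False by decide,
    show ((0 : Fin 3) = 1) = False by decide, show ((1 : Fin 3) = 0) = False by decide]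
  exact coeff_identity_B (m 0) (m 1) (m 2)

/-- **Straub 2014, Theorem 1.1 with (7)–(8)** — PROVED:
`((1 − x₁ − x₂)(1 − x₃ − x₄) − x₁x₂x₃x₄) · Σ_{𝐧 ≥ 0} A(𝐧) 𝐱^𝐧 = 1` in `ℤ⟦x₁,x₂,x₃,x₄⟧`, where
`A(𝐧) = Σ_k C(n₁,k) C(n₃,k) C(n₁+n₂−k,n₁) C(n₃+n₄−k,n₃)` is the binomial sum (8); with `straubA_diag`,
the Apéry numbers `A(n) = A(n,n,n,n)` are the diagonal Taylor coefficients of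
`1/((1 − x₁ − x₂)(1 − x₃ − x₄) − x₁x₂x₃x₄)` (Theorem 1.1).  Discharges the named fact `theorem11`.
[cite: Straub2014, Theorem 1.1, (7)–(8)] -/
theorem theorem11_holds : theorem11 := by
  classical
  unfold theorem11
  rw [straubDenomA_coe_eq]
  ext m
  simp only [sub_mul, add_mul, one_mul, map_sub, map_add, coeff_monomial_mul, coeff_straubSeriesA,
    MvPowerSeries.coeff_one, le_iff_fin4, eq_zero_iff_fin4, Finsupp.tsub_apply, Finsupp.add_apply,
    Finsupp.single_apply]
  simp only [Fin.isValue, ↓reduceIte, zero_le, true_and, and_true, add_zero, zero_add, tsub_zero,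
    show ((0 : Fin 4) = 1) = False by decide, show ((1 : Fin 4) = 0) = False by decide,
    show ((0 : Fin 4) = 2) = False by decide, show ((2 : Fin 4) = 0) = False by decide,
    show ((0 : Fin 4) = 3) = False by decide, show ((3 : Fin 4) = 0) = False by decide,
    show ((1 : Fin 4) = 2) = False by decide, show ((2 : Fin 4) = 1) = False by decide,
    show ((1 : Fin 4) = 3) = False by decide, show ((3 : Fin 4) = 1) = False by decide,
    show ((2 : Fin 4) = 3) = False by decide, show ((3 : Fin 4) = 2) = False by decide]
  exact coeff_identity_A (m 0) (m 1) (m 2) (m 3)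

end Discharges

end Literature.Combinatorics.Enumerative.MultivariateAperyNumbers
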